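import Summits.Ventures.LatticeQCDFlow.Scoring.WolffWindow

/-!
# Wolff's automatic window, typed (II): the criterion as a derivative, termination, and the end-to-end statement at `S = 3/2`

HONEST FRAMING: exact (Metropolis-corrected) sampling algorithms for lattice gauge theory;
figures of merit are autocorrelation/cost numbers at stated couplings and volumes; no
continuum-physics claim.

Venture `LatticeQCDFlow` (cell pub-lqcd), sub-topic `Scoring`; FANOUT row 11 (`eng-scorerA`).
NEW WORK of the cell; companion of `Scoring/WolffWindow.lean` (the definitions `wolffTau`, `wolffG`,
`IsWolffWindow`, `tauExp`, `corrFactor`, `relBias` and the conservativeness theorem live there;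
Wolff, Comput. Phys. Commun. 156 (2004) §3.3 is cited for the procedure only).

## Content

* `sqrt_le_wolffDTau_div`, **`relBias_lt_mul_statErr`**: under the hypotheses of
  `relBias_lt_of_wolffG_neg` and `2 τ_int ≤ W + 1`, the truncation bias the stopping rule leaves is
  `< S τ_exp/(√2 · W)` times the relative statistical error `δτ/τ` the scorer reports at that window
  (`CalibrationTruths.wolffDTau`; e.g. `S = 3/2`, `W = 6 τ_exp`: below 17.7 % of it).
* `wolffErrProxy`, `hasDerivAt_wolffErrProxy`, `wolffG_eq_neg_mul_deriv`, `wolffG_neg_iff_deriv_pos`: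
  `g(W) = −τ_S · E′(W)` for Wolff's total-error proxy `E(w) = exp(−w/τ_S) + 2 √(w/N)` (modelled
  relative truncation bias + leading-order relative statistical error of the windowed sum), so the
  rule `g(W) < 0` stops exactly where `E` starts to rise (for `τ_S` held fixed).
* `wolffTau_window_ge` (`τ_S(τ_W) ≥ S/(log(1/r) + 1)` along the C-1 curve),
  **`exists_wolffG_neg_geometric`**, `exists_isWolffWindow_geometric`, `isWolffWindow_unique`: on the
  C-1 curve the criterion does turn negative, so THE automatic window exists (and is unique) for
  every `N > 0` — gamma.py's `failed` branch is about the finite `W_max` of real data, not the curve.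
* `two_tauExp_le_of_isWolffWindow`: if `N ≥ S² e^{6/S} τ_exp²` the automatic window is `≥ 2 τ_exp`
  (no early stop: before `2 τ_exp` the exponential term still exceeds `e^{−3/S} ≥ S τ_exp/√N`);
  **`relBias_at_wolffWindow_frozen`**: hence at `S = 3/2` and `N ≥ (9/4) e⁴ τ_exp² ≈ 123 τ_exp²` the
  relative truncation bias at THE automatic window is below `τ_{3/2}(τ_W)/√(W N) < (3/2) τ_exp/√(W N)`
  with no further hypothesis — met by the calibration of record (C-1 `r = 0.99`, `τ_exp ≈ 99.5`, at
  `N = 10⁷ ≥ 1.22·10⁶`; `r = 0.9`, `0.5` at any `N ≥ 1.2·10⁴`), not by `r = 0.99` at the literal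
  `N = 10⁶` (a sufficient condition only).
-/

namespace Summit.Ventures.LatticeQCDFlow.Scoring

open scoped BigOperators
open Real

/-! ## Bias versus the reported statistical error -/

/-- Wolff's leading-order relative statistical error at window `W` is at least `√(2W/N)` once
`2 τ ≤ W + 1` (then `W + 1/2 − τ ≥ W/2`). -/
theorem sqrt_le_wolffDTau_div {τ N : ℝ} {W : ℕ} (hτ : 0 < τ) (hN : 0 < N) (hW : 2 * τ ≤ W + 1) :
    Real.sqrt (2 * W / N) ≤ wolffDTau τ W N / τ := by
  unfold wolffDTau
  have hrw : 2 * τ * Real.sqrt ((W + 1 / 2 - τ) / N) / τ = 2 * Real.sqrt ((W + 1 / 2 - τ) / N) := by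
    field_simp
  rw [hrw]
  have h4 : Real.sqrt (2 * W / N) = 2 * Real.sqrt (W / (2 * N)) := by
    rw [show (2 : ℝ) = Real.sqrt 4 by rw [show (4:ℝ) = 2 ^ 2 by norm_num, Real.sqrt_sq (by norm_num)],
      ← Real.sqrt_mul (by norm_num)]
    congr 1
    rw [show Real.sqrt 4 = (2 : ℝ) by rw [show (4:ℝ) = 2 ^ 2 by norm_num, Real.sqrt_sq (by norm_num)]]
    field_simp
    ring
  rw [h4]
  refine mul_le_mul_of_nonneg_left (Real.sqrt_le_sqrt ?_) (by norm_num)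
  rw [div_le_div_iff₀ (by positivity) hN]
  nlinarith

/-- **Bias versus the reported statistical error.**  Under the hypotheses of
`relBias_lt_of_wolffG_neg` and `2 τ_int ≤ W + 1`, the truncation bias the stopping rule leaves is
below `S τ_exp/(√2 · W)` times the relative statistical error `δτ/τ` the scorer reports at that window
(e.g. `S = 3/2`, `W = 6 τ_exp`: below `17.7 %` of it). -/
theorem relBias_lt_mul_statErr {S N r : ℝ} (hS : 1 < S) (hN : 0 < N) (hr0 : 0 < r) (hr1 : r < 1)
    {W : ℕ} (hW : 1 ≤ W) (hWlarge : tauExp r / (S - 1) ≤ W)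
    (hWτ : 2 * tauInt (fun t => r ^ t) ≤ W + 1)
    (hg : wolffG S N W (tauIntWindow (fun t => r ^ t) W) < 0) :
    relBias (fun t => r ^ t) W
      < S * tauExp r / (Real.sqrt 2 * W) * (wolffDTau (tauInt (fun t => r ^ t)) W N / tauInt (fun t => r ^ t)) := by
  have hS0 : 0 < S := by linarith
  have hW0 : (0 : ℝ) < W := by exact_mod_cast hW
  have hτe := tauExp_pos hr0 hr1
  have habs : |r| < 1 := abs_lt.mpr ⟨by linarith, hr1⟩
  have hτi : 0 < tauInt (fun t => r ^ t) := by
    rw [tauInt_geometric habs]; exact div_pos (by linarith) (by linarith)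
  obtain ⟨h1, h2⟩ := relBias_lt_of_wolffG_neg hS hN hr0 hr1 hW hWlarge hg
  have hstat := sqrt_le_wolffDTau_div hτi hN hWτ
  have hcoef : 0 < S * tauExp r / (Real.sqrt 2 * W) := by positivity
  -- S τe/√(W N) = (S τe/(√2 W)) · √(2W/N)
  have hkey : S * tauExp r / Real.sqrt (W * N) = S * tauExp r / (Real.sqrt 2 * W) * Real.sqrt (2 * W / N) := by
    have hsqW : Real.sqrt (W : ℝ) ≠ 0 := (Real.sqrt_pos.mpr hW0).ne'
    have hsq2 : Real.sqrt 2 ≠ 0 := by positivity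
    rw [Real.sqrt_div' _ hN.le, Real.sqrt_mul (by norm_num : (0:ℝ) ≤ 2), Real.sqrt_mul hW0.le,
      div_mul_div_comm,
      show S * tauExp r * (Real.sqrt 2 * Real.sqrt W) = Real.sqrt 2 * (Real.sqrt W * (S * tauExp r)) by ring,
      show Real.sqrt 2 * (W : ℝ) * Real.sqrt N = Real.sqrt 2 * (Real.sqrt W * (Real.sqrt W * Real.sqrt N)) by
        rw [← mul_assoc (Real.sqrt (W : ℝ)), Real.mul_self_sqrt hW0.le]; ring,
      mul_div_mul_left _ _ hsq2, mul_div_mul_left _ _ hsqW]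
  calc relBias (fun t => r ^ t) W
      < S * tauExp r / Real.sqrt (W * N) := h1.trans h2
    _ = S * tauExp r / (Real.sqrt 2 * W) * Real.sqrt (2 * W / N) := hkey
    _ ≤ S * tauExp r / (Real.sqrt 2 * W) * (wolffDTau (tauInt (fun t => r ^ t)) W N / tauInt (fun t => r ^ t)) :=
        mul_le_mul_of_nonneg_left hstat hcoef.le

/-! ## The criterion is the derivative of Wolff's total-error proxy

Wolff derives the rule by minimising, over `W`, the sum of the modelled relative systematic error
`exp(−W/τ)` and the leading-order relative statistical error `2 √(W/N)` of the windowed sum: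
`g(W)` is exactly `−τ · E′(W)`, so "first `W` with `g(W) < 0`" = "first `W` past the minimum of `E`"
(for `τ` held fixed). -/

/-- Wolff's total-error proxy `E(w) = exp(−w/τ) + 2 √(w/N)`. -/
noncomputable def wolffErrProxy (τ N w : ℝ) : ℝ :=
  Real.exp (-w / τ) + 2 * Real.sqrt (w / N)

/-- `E′(w) = −(exp(−w/τ) − τ/√(w N))/τ` for `τ ≠ 0`, `N > 0`, `w > 0`. -/
theorem hasDerivAt_wolffErrProxy {τ N w : ℝ} (hτ : τ ≠ 0) (hN : 0 < N) (hw : 0 < w) :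
    HasDerivAt (wolffErrProxy τ N) (-(Real.exp (-w / τ) - τ / Real.sqrt (w * N)) / τ) w := by
  have h1 : HasDerivAt (fun x : ℝ => -x / τ) (-1 / τ) w := by
    simpa using ((hasDerivAt_id w).neg).div_const τ
  have hexp : HasDerivAt (fun x : ℝ => Real.exp (-x / τ)) (Real.exp (-w / τ) * (-1 / τ)) w := h1.exp
  have hwN : w / N ≠ 0 := (div_pos hw hN).ne'
  have hsq : HasDerivAt (fun x : ℝ => Real.sqrt (x / N)) ((1 / N) / (2 * Real.sqrt (w / N))) w := by
    simpa using ((hasDerivAt_id w).div_const N).sqrt (by simpa using hwN)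
  have hsum := hexp.add (hsq.const_mul 2)
  refine HasDerivAt.congr_deriv (f := wolffErrProxy τ N) (by exact hsum) ?_
  have hsw : 0 < Real.sqrt w := Real.sqrt_pos.mpr hw
  have hsN : 0 < Real.sqrt N := Real.sqrt_pos.mpr hN
  rw [Real.sqrt_div' w hN.le, Real.sqrt_mul hw.le N]
  have hNN : Real.sqrt N * Real.sqrt N = N := Real.mul_self_sqrt hN.le
  rw [show (1 : ℝ) / N = 1 / (Real.sqrt N * Real.sqrt N) by rw [hNN]]
  field_simp
  ring

/-- Hence **`g(W) = −τ_S · E′(W)`** with `τ = τ_S(τ̂_W)` held fixed … -/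
theorem wolffG_eq_neg_mul_deriv {S N : ℝ} {W : ℕ} {τi : ℝ} (hτ : wolffTau S τi ≠ 0) (hN : 0 < N)
    (hW : 1 ≤ W) :
    wolffG S N W τi = -(wolffTau S τi) * deriv (wolffErrProxy (wolffTau S τi) N) W := by
  have hW0 : (0 : ℝ) < W := by exact_mod_cast hW
  rw [(hasDerivAt_wolffErrProxy hτ hN hW0).deriv, wolffG]
  field_simp

/-- … so the stopping rule `g(W) < 0` says precisely that the proxy has started to INCREASE at `W`
(`τ_S > 0`). -/
theorem wolffG_neg_iff_deriv_pos {S N : ℝ} {W : ℕ} {τi : ℝ} (hτ : 0 < wolffTau S τi) (hN : 0 < N)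
    (hW : 1 ≤ W) :
    wolffG S N W τi < 0 ↔ 0 < deriv (wolffErrProxy (wolffTau S τi) N) W := by
  rw [wolffG_eq_neg_mul_deriv hτ.ne' hN hW, neg_mul, neg_lt_zero]
  exact ⟨fun h => (pos_iff_pos_of_mul_pos h).mp hτ, fun h => mul_pos hτ h⟩

/-! ## The procedure terminates on C-1 (population version)

On the noise-free C-1 curve `W ↦ τ_W` the criterion does become negative: the exponential term is
below `exp(−W/(S τ_exp))` while the subtracted term is at least `(S/(log(1/r) + 1))/√(W N)`, and
`√W · exp(−W/(S τ_exp)) → 0`.  So the automatic window — the FIRST such `W` — exists for every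
`N > 0` (gamma.py's `failed` branch is about the finite `W_max = N/2` of real data, not about the
curve). -/

/-- A uniform lower bound for the implied scale along the C-1 curve: `τ_S(τ_W) ≥ S/(log(1/r) + 1)`. -/
theorem wolffTau_window_ge {S r : ℝ} (hS : 0 < S) (hr0 : 0 < r) (hr1 : r < 1) {W : ℕ} (hW : 1 ≤ W) :
    S / (Real.log (1 / r) + 1) ≤ wolffTau S (tauIntWindow (fun t => r ^ t) W) := by
  rw [wolffTau_window_geometric S hr0 hr1 hW]
  have hl := Real.log_pos (one_lt_one_div hr0 hr1)
  have ⟨hc0, hc1⟩ := log_corrFactor_bounds hr0 hr1 hW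
  have hW1 : (1 : ℝ) / W ≤ 1 := by
    rw [div_le_one (by exact_mod_cast hW)]; exact_mod_cast hW
  exact div_le_div_of_nonneg_left hS.le (by linarith) (by linarith)

/-- **Termination on C-1.** For `S > 0`, `N > 0`, `0 < r < 1` some window `W ≥ 1` has `g(W) < 0`. -/
theorem exists_wolffG_neg_geometric {S N r : ℝ} (hS : 0 < S) (hN : 0 < N) (hr0 : 0 < r) (hr1 : r < 1) :
    ∃ W : ℕ, 1 ≤ W ∧ wolffG S N W (tauIntWindow (fun t => r ^ t) W) < 0 := by
  set τe := tauExp r with hτe_def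
  have hτe : 0 < τe := tauExp_pos hr0 hr1
  set τlo := S / (Real.log (1 / r) + 1) with hτlo_def
  have hτlo : 0 < τlo := div_pos hS (by linarith [Real.log_pos (one_lt_one_div hr0 hr1)])
  -- choose W ≥ max(1, 2 S² τe² √N / τlo + 1)
  obtain ⟨W, hWge⟩ := exists_nat_ge (2 * S ^ 2 * τe ^ 2 * Real.sqrt N / τlo + 1)
  have hbig : 2 * S ^ 2 * τe ^ 2 * Real.sqrt N / τlo < W := by linarith
  have hW1r : (1 : ℝ) ≤ W := by
    have : 0 ≤ 2 * S ^ 2 * τe ^ 2 * Real.sqrt N / τlo := by positivity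
    linarith
  have hW : 1 ≤ W := by exact_mod_cast hW1r
  have hW0 : (0 : ℝ) < W := by linarith
  refine ⟨W, hW, ?_⟩
  have hsN : 0 < Real.sqrt N := Real.sqrt_pos.mpr hN
  have hsWN : 0 < Real.sqrt (W * N) := Real.sqrt_pos.mpr (mul_pos hW0 hN)
  -- (1) the exponential term
  have hτW := wolffTau_window_lt S hS hr0 hr1 hW
  have hτWpos := wolffTau_window_pos hS hr0 hr1 hW
  have hexp1 : Real.exp (-(W : ℝ) / wolffTau S (tauIntWindow (fun t => r ^ t) W))
      < Real.exp (-(W : ℝ) / (S * τe)) := by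
    rw [Real.exp_lt_exp, neg_div, neg_div, neg_lt_neg_iff]
    exact div_lt_div_of_pos_left hW0 hτWpos hτW
  -- `exp(−x) ≤ 2/x²` for `x > 0`, from `1 + x + x²/2 ≤ exp x` (the tree has this as
  -- `Literature.NumberTheory.Automorphic.exp_neg_le_two_div_sq`; re-derived locally in three lines
  -- rather than importing a modular-forms module into the scorer's file)
  have hexp_le : ∀ x : ℝ, 0 < x → Real.exp (-x) ≤ 2 / x ^ 2 := by
    intro x hx
    have h := Real.quadratic_le_exp_of_nonneg hx.le
    rw [Real.exp_neg, inv_eq_one_div, div_le_div_iff₀ (Real.exp_pos x) (by positivity)]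
    nlinarith
  have hexp2 : Real.exp (-(W : ℝ) / (S * τe)) ≤ 2 / ((W : ℝ) / (S * τe)) ^ 2 := by
    rw [neg_div]; exact hexp_le _ (by positivity)
  -- (2) the subtracted term
  have hsub : τlo / Real.sqrt (W * N) ≤ wolffTau S (tauIntWindow (fun t => r ^ t) W) / Real.sqrt (W * N) :=
    div_le_div_of_nonneg_right (wolffTau_window_ge hS hr0 hr1 hW) hsWN.le
  -- (3) 2/(W/(Sτe))² < τlo/√(W N)  ⟸  2 S² τe² √(W N) < τlo W²  ⟸ √(W N) ≤ W √N and 2 S² τe² √N < τlo W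
  have hsqrtW : Real.sqrt (W * N) ≤ W * Real.sqrt N := by
    rw [Real.sqrt_mul hW0.le]
    refine mul_le_mul_of_nonneg_right ?_ hsN.le
    rw [Real.sqrt_le_left hW0.le]
    nlinarith
  have h3 : 2 * S ^ 2 * τe ^ 2 * Real.sqrt N < τlo * W := by
    have := (div_lt_iff₀ hτlo).mp hbig
    linarith
  have hkey1 : 2 / ((W : ℝ) / (S * τe)) ^ 2 = 2 * S ^ 2 * τe ^ 2 / (W : ℝ) ^ 2 := by
    rw [div_pow, div_div_eq_mul_div]
    ring
  have hkey2 : 2 * S ^ 2 * τe ^ 2 / (W : ℝ) ^ 2 < τlo / (W * Real.sqrt N) := by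
    rw [div_lt_div_iff₀ (by positivity) (by positivity)]
    have := mul_lt_mul_of_pos_left h3 hW0
    linarith
  have hkey3 : τlo / (W * Real.sqrt N) ≤ τlo / Real.sqrt (W * N) :=
    div_le_div_of_nonneg_left hτlo.le hsWN hsqrtW
  have hkey : 2 / ((W : ℝ) / (S * τe)) ^ 2 < τlo / Real.sqrt (W * N) := by
    rw [hkey1]; exact hkey2.trans_le hkey3
  unfold wolffG
  linarith

/-- **The automatic window exists on C-1**: there is a (unique) first `W ≥ 1` with `g(W) < 0`. -/
theorem exists_isWolffWindow_geometric {S N r : ℝ} (hS : 0 < S) (hN : 0 < N) (hr0 : 0 < r) (hr1 : r < 1) :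
    ∃ W : ℕ, IsWolffWindow S N (fun W => tauIntWindow (fun t => r ^ t) W) W := by
  classical
  have hex := exists_wolffG_neg_geometric hS hN hr0 hr1
  refine ⟨Nat.find hex, (Nat.find_spec hex).1, (Nat.find_spec hex).2, ?_⟩
  intro W' hW'1 hW'lt
  have hmin := Nat.find_min hex hW'lt
  exact not_lt.mp (fun h => hmin ⟨hW'1, h⟩)

/-- The automatic window is unique (first crossing). -/
theorem isWolffWindow_unique {S N : ℝ} {τW : ℕ → ℝ} {W₁ W₂ : ℕ}
    (h₁ : IsWolffWindow S N τW W₁) (h₂ : IsWolffWindow S N τW W₂) : W₁ = W₂ := by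
  rcases h₁ with ⟨h1a, h1b, h1c⟩
  rcases h₂ with ⟨h2a, h2b, h2c⟩
  by_contra hne
  rcases lt_or_gt_of_ne hne with hlt | hgt
  · exact absurd h1b (not_lt.mpr (h2c W₁ h1a hlt))
  · exact absurd h2b (not_lt.mpr (h1c W₂ h2a hgt))

/-! ## End to end at the frozen `S = 3/2`: the automatic window is late enough once `N ≳ 123 τ_exp²`

The guarantee `relBias_lt_of_wolffG_neg` asks for `W ≥ τ_exp/(S − 1)`.  The automatic window itself
is that large as soon as `N ≥ S² e^{6/S} τ_exp²`: before `2 τ_exp` the exponential term still exceeds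
`e^{−3/S}` while the subtracted term is below `S τ_exp/√N ≤ e^{−3/S}`, so the criterion cannot yet be
negative.  At `S = 3/2` the threshold is `(9/4) e⁴ τ_exp² ≈ 123 τ_exp²` — met by the calibration of
record (C-1 `r = 0.99`, `τ_exp ≈ 99.5`, at `N = 10⁷ ≥ 1.22 · 10⁶`; `r = 0.9` and `0.5` at any
`N ≥ 1.2 · 10⁴`), NOT met by `r = 0.99` at the literal `N = 10⁶` (a sufficient condition only). -/

/-- **No early stop.** If `S² τ_exp² e^{6/S} ≤ N`, the automatic window on the C-1 curve satisfies
`2 τ_exp ≤ W`. -/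
theorem two_tauExp_le_of_isWolffWindow {S N r : ℝ} (hS : 0 < S) (hr0 : 0 < r) (hr1 : r < 1)
    (hN : S ^ 2 * tauExp r ^ 2 * Real.exp (6 / S) ≤ N) {W : ℕ}
    (hWin : IsWolffWindow S N (fun W => tauIntWindow (fun t => r ^ t) W) W) :
    2 * tauExp r ≤ W := by
  obtain ⟨hW, hg, -⟩ := hWin
  have hτe := tauExp_pos hr0 hr1
  have hNpos : 0 < N := lt_of_lt_of_le (by positivity) hN
  have hW0 : (0 : ℝ) < W := by exact_mod_cast hW
  have hsN : 0 < Real.sqrt N := Real.sqrt_pos.mpr hNpos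
  have hsWN : 0 < Real.sqrt (W * N) := Real.sqrt_pos.mpr (mul_pos hW0 hNpos)
  by_contra hlt
  rw [not_le] at hlt
  -- (a) the exponential term exceeds exp(−3/S)
  have ha : Real.exp (-(3 : ℝ) / S) < Real.exp (-(W : ℝ) / wolffTau S (tauIntWindow (fun t => r ^ t) W)) := by
    rw [Real.exp_lt_exp, neg_div, neg_div, neg_lt_neg_iff]
    refine (div_wolffTau_window_le hS hr0 hr1 hW).trans_lt ?_
    rw [div_lt_div_iff_of_pos_right hS]
    have : (W : ℝ) / tauExp r < 2 := by
      rw [div_lt_iff₀ hτe]; linarith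
    linarith
  -- (b) the subtracted term is below S τe/√N
  have hb : wolffTau S (tauIntWindow (fun t => r ^ t) W) / Real.sqrt (W * N) < S * tauExp r / Real.sqrt N := by
    calc wolffTau S (tauIntWindow (fun t => r ^ t) W) / Real.sqrt (W * N)
        < S * tauExp r / Real.sqrt (W * N) := div_lt_div_of_pos_right (wolffTau_window_lt S hS hr0 hr1 hW) hsWN
      _ ≤ S * tauExp r / Real.sqrt N := by
          refine div_le_div_of_nonneg_left (by positivity) hsN (Real.sqrt_le_sqrt ?_)
          have hW1 : (1 : ℝ) ≤ W := by exact_mod_cast hW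
          have := mul_le_mul_of_nonneg_right hW1 hNpos.le
          linarith
  -- (c) S τe/√N ≤ exp(−3/S) from the hypothesis on N
  have hc : S * tauExp r / Real.sqrt N ≤ Real.exp (-(3 : ℝ) / S) := by
    have hA : 0 ≤ S * tauExp r * Real.exp (3 / S) := by positivity
    have hA2 : (S * tauExp r * Real.exp (3 / S)) ^ 2 ≤ N := by
      have : Real.exp (3 / S) ^ 2 = Real.exp (6 / S) := by
        rw [← Real.exp_nat_mul]; congr 1; ring
      calc (S * tauExp r * Real.exp (3 / S)) ^ 2 = S ^ 2 * tauExp r ^ 2 * Real.exp (6 / S) := by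
            rw [mul_pow, mul_pow, this]
        _ ≤ N := hN
    have hAle : S * tauExp r * Real.exp (3 / S) ≤ Real.sqrt N := by
      have := Real.sqrt_le_sqrt hA2
      rwa [Real.sqrt_sq hA] at this
    rw [div_le_iff₀ hsN, neg_div, Real.exp_neg, le_inv_mul_iff₀ (Real.exp_pos _)]
    linarith [hAle]
  have : 0 < wolffG S N W (tauIntWindow (fun t => r ^ t) W) := by
    unfold wolffG; linarith
  linarith

/-- **End to end at the frozen `S = 3/2`.** If `(9/4) e⁴ τ_exp² ≤ N`, the relative truncation bias at
THE automatic window `W` of the C-1 curve is below `τ_{3/2}(τ_W)/√(W N) < (3/2) τ_exp/√(W N)` — the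
term the criterion trades it against — with no further hypothesis. -/
theorem relBias_at_wolffWindow_frozen {N r : ℝ} (hr0 : 0 < r) (hr1 : r < 1)
    (hN : (3 / 2 : ℝ) ^ 2 * tauExp r ^ 2 * Real.exp 4 ≤ N) {W : ℕ}
    (hWin : IsWolffWindow (3 / 2) N (fun W => tauIntWindow (fun t => r ^ t) W) W) :
    relBias (fun t => r ^ t) W < wolffTau (3 / 2) (tauIntWindow (fun t => r ^ t) W) / Real.sqrt (W * N) ∧
      wolffTau (3 / 2) (tauIntWindow (fun t => r ^ t) W) / Real.sqrt (W * N)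
        < 3 / 2 * tauExp r / Real.sqrt (W * N) := by
  have hτe := tauExp_pos hr0 hr1
  have hNpos : 0 < N := lt_of_lt_of_le (by positivity) hN
  have hN' : (3 / 2 : ℝ) ^ 2 * tauExp r ^ 2 * Real.exp (6 / (3 / 2)) ≤ N := by
    rwa [show (6 : ℝ) / (3 / 2) = 4 by norm_num]
  have h2 := two_tauExp_le_of_isWolffWindow (by norm_num) hr0 hr1 hN' hWin
  have hWlarge : tauExp r / (3 / 2 - 1) ≤ W := by
    rwa [show tauExp r / (3 / 2 - 1) = 2 * tauExp r by ring]
  exact relBias_lt_of_wolffG_neg (by norm_num) hNpos hr0 hr1 hWin.1 hWlarge hWin.2.1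

end Summit.Ventures.LatticeQCDFlow.Scoring
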